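import Mathlib
import Summits.Ventures.PercRepro2.CoinTreeCore
import Summits.Ventures.PercRepro2.CoinOrTailAlg
import Summits.Ventures.PercRepro2.CoinOrTailDefs
import Summits.Ventures.PercRepro2.CoinOrTailLsmDefs
import Summits.Ventures.PercRepro2.CoinOrTailLsmSums
import Summits.Ventures.PercRepro2.CoinTreeAncestor
import Summits.Ventures.PercRepro2.CoinOrTailBlockAlg
import Summits.Ventures.PercRepro2.CoinOrTailBlockSums
import Summits.Ventures.PercRepro2.CoinOrTailDomCore

/-!
# Both markers FAR on DIFFERENT routes — an instantiation check (blind cell PercRepro2, night-2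
g9 session 2; NIGHT2-DARC.md §39)

A concrete coin system on `Fin 9` (s = 0, p₁ = 1, p₂ = 2, q₁ = 3, q₂ = 4, a = 5, w = 6, v = 7,
t = 8): the two routes `s → p₁ → p₂ → a` and `s → q₁ → q₂ → a` meet at the tail `a`; the head
has the entries `p₁ → w`, `q₁ → v`, `a → v`, the arm `w → v` and `v → t` — eleven coins, all
random.  The core `U = {p₁, p₂, q₁, q₂}` is an out-tree (`TreeCore`, by `decide`), the tail is an
OR-tail with the entries `p₂, q₂` (`OrTailU`, by `decide`), and the markers are the FAR vertices
`p₁ = par p₂`, `q₁ = par q₂` — one on each route.  `darc_of_orTailTreeDom` gives row 2′DARC at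
`a → w` for the markers `p₁, q₁` and every probability vector: the `(2, 2)` far-far core whose
degree-3 LP certificates do not exist (NIGHT2-DARC §37), closed by the block theorem.
-/

namespace Summit.Ventures.PercRepro2.Coin

namespace OrTailDomExample

open Classical

/-- The eleven coins of the example. -/
def arcsEx : Fin 11 → Finset (Fin 9 × Fin 9)
  | 0 => {(0, 1)}   -- s → p₁
  | 1 => {(1, 2)}   -- p₁ → p₂
  | 2 => {(0, 3)}   -- s → q₁
  | 3 => {(3, 4)}   -- q₁ → q₂
  | 4 => {(2, 5)}   -- cρ : p₂ → a
  | 5 => {(4, 5)}   -- cτ : q₂ → a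
  | 6 => {(1, 6)}   -- p₁ → w
  | 7 => {(3, 7)}   -- q₁ → v
  | 8 => {(5, 7)}   -- a → v
  | 9 => {(6, 7)}   -- arm w → v
  | 10 => {(7, 8)}  -- v → t

/-- The tree coins: `c p₁ = 0`, `c p₂ = 1`, `c q₁ = 2`, `c q₂ = 3`. -/
def cEx : Fin 9 → Fin 11
  | 1 => 0
  | 2 => 1
  | 3 => 2
  | 4 => 3
  | _ => 0

/-- The parent map: `par p₁ = s`, `par p₂ = p₁`, `par q₁ = s`, `par q₂ = q₁`. -/
def parEx : Fin 9 → Fin 9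
  | 1 => 0
  | 2 => 1
  | 3 => 0
  | 4 => 3
  | _ => 0

/-- The rank. -/
def rkEx : Fin 9 → ℕ
  | 1 => 1
  | 2 => 2
  | 3 => 1
  | 4 => 2
  | _ => 0

/-- Every coin is a single arc, so `SameEnds` holds. -/
lemma sameEnds_ex : SameEnds arcsEx := by
  intro e xy hxy x'y' hx'y'
  fin_cases e <;> simp [arcsEx] at hxy hx'y' <;> subst hxy <;> subst hx'y' <;>
    exact ⟨Or.inl rfl, Or.inr rfl⟩

/-- `{p₁, p₂, q₁, q₂}` is an out-tree core of `s`. -/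
lemma treeCore_ex : TreeCore arcsEx 0 {1, 2, 3, 4} cEx parEx rkEx where
  tree := by decide
  par_mem := by decide
  rank := by decide
  into_C := by decide
  into_s := by decide
  s_notin := by decide

/-- The core with the tail `a = 5` entered from `p₂ = 2` (coin `4`) and `q₂ = 4` (coin `5`) is an
OR-tail. -/
lemma orTailU_ex : OrTailU arcsEx 0 {1, 2, 3, 4} 2 4 5 4 5 where
  p_mem := by decide
  q_mem := by decide
  s_notin := by decide
  a_notin := by decide
  a_ne_s := by decide
  into_U := by decide
  into_s := by decide
  into_a := by decide
  arcs_ρ := by decide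
  arcs_τ := by decide
  ρτ_ne := by decide

/-- **Row 2′DARC at the arc `a → w` of the two-route core `s → p₁ → p₂ → a ← q₂ ← q₁ ← s` for
the FAR markers `p₁, q₁` (one on each route) and every probability vector** — no hypothesis
beyond `IsProbVec`. -/
theorem darc_orTailDom_example {R : Type*} [Field R] [LinearOrder R] [IsStrictOrderedRing R]
    (pr : Fin 11 → R) (hp : IsProbVec pr) :
    DARC pr arcsEx 0 {8} 1 3 5 6 :=
  darc_of_orTailTreeDom pr hp sameEnds_ex orTailU_ex treeCore_ex (by decide) (by decide)
    (i := 1) (by decide) (by decide) (j := 1) (by decide) (by decide)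
    (by decide) (by decide) (by decide) (by decide)

end OrTailDomExample

end Summit.Ventures.PercRepro2.Coin
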